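import Mathlib
import Literature.AlgebraicGeometry.Resolution.CobordantGame
import Summits.ResolutionOfSingularities.ResolutionOfSingularities.Theorems.WeightedInvariantLocalWeightedDropTwistedTrivialCylinder

/-!
# `WeightedInvariant.LocalWeightedDrop`: DESCENT of twisted triviality from a cylinder (§9 R4-6b-ii, rule-free part)

Route `ResolutionOfSingularities/WeightedInvariant`, crux `LocalWeightedDrop`
(stmt-ResolutionOfSingularities-8899).  [OURS · L1 W4.3] — the converse of `GradedGame.twistedTrivialAlongFix_cylinder_castSucc`
(`…TwistedTrivialCylinder`, R4-6 conj. 2): the question left open in ideator res-L1-w43-idea-1's Sketch v4 §9 R4-6 («a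
`v`-dependent `Φ` could in principle saturate a direction of `F ⊗ 1` that is not saturated for `F`; setting `v = 0` should rule
this out, unproved»; R4-6b-ii «descent `satSet(F⊗1) ⊆ castSucc(satSet F) ∪ {last}`», ADDENDUM 2026-08-27T08:33:07Z).  Nothing
here is a statement of the manuscript under review on ladder RESOLUTION; AI-produced, weaker than expert review.

THEOREM `twistedTrivialAlongFix_of_cylinder` (`p ≠ 0`): `F ⊗ 1` Fix-trivial along `castSucc i` ⇒ `F` Fix-trivial along `xᵢ`;
exact form `twistedTrivialAlongFix_cylinder_iff`.  PROOF: specialise the idle variable, `v := s(x)`.  `v := 0` is NOT always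
enough (the principal `x/x` block `A` of the linear part `M'` of `Φ'` may be singular although `M'` is invertible); `v := xₘ`
has linear part `A[m ← Aₘ + b]` (`b` = `v`-column of the `x`-rows), determinant `det A + det A[m ← b]`, and
`exists_det_ne_zero_principal_or_updateCol` (the `x`-rows of `M'` are independent, so not all of `e_v, e_{xₘ}` lie in their
span) gives `det A ≠ 0` or some `det A[m ← b] ≠ 0`.
-/

set_option linter.dupNamespace false -- mandated namespace of this single-conjunct summit
set_option autoImplicit false

namespace Summit.ResolutionOfSingularities.ResolutionOfSingularities.Theorems

namespace GradedGame

open MvPowerSeries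
open Literature.AlgebraicGeometry.Resolution

variable {k : Type} [Field k]

/-- For an invertible `(n+1) × (n+1)` matrix `M` with principal `n × n` block `A` (rows/columns `castSucc`) and last column
`b` (rows `castSucc`): either `det A ≠ 0`, or some `det (A with column m replaced by b) ≠ 0`.  (The `castSucc`-rows of `M` are
linearly independent; if all these determinants vanished, every standard basis vector would lie in their span.) [OURS · L1 W4.3] -/
theorem exists_det_ne_zero_principal_or_updateCol {n : ℕ} (M : Matrix (Fin (n + 1)) (Fin (n + 1)) k) (hM : M.det ≠ 0) :
    (M.submatrix Fin.castSucc Fin.castSucc).det ≠ 0 ∨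
      ∃ m : Fin n, ((M.submatrix Fin.castSucc Fin.castSucc).updateCol m
        (fun a => M (Fin.castSucc a) (Fin.last n))).det ≠ 0 := by
  classical
  by_contra hcon
  push Not at hcon
  obtain ⟨hA, hB⟩ := hcon
  set A : Matrix (Fin n) (Fin n) k := M.submatrix Fin.castSucc Fin.castSucc with hAdef
  set T : Fin n → (Fin (n + 1) → k) := fun a => M (Fin.castSucc a) with hTdef
  have hT : LinearIndependent k T :=
    (Matrix.linearIndependent_rows_of_det_ne_zero hM).comp Fin.castSucc (Fin.castSucc_injective n)
  -- a vanishing `n × n` determinant gives a combination of the `T a` supported on one coordinate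
  have hcomb : ∀ (r : Fin n → k) (w : Fin (n + 1)), r ≠ 0 →
      (∀ w', w' ≠ w → (∑ a, r a * M (Fin.castSucc a) w') = 0) →
      (Pi.single w (1 : k) : Fin (n + 1) → k) ∈ Submodule.span k (Set.range T) := by
    intro r w hr hzero
    set V : Fin (n + 1) → k := ∑ a, r a • T a with hV
    have hVmem : V ∈ Submodule.span k (Set.range T) :=
      Submodule.sum_mem _ fun a _ => Submodule.smul_mem _ _ (Submodule.subset_span ⟨a, rfl⟩)
    have hVapp : ∀ w', V w' = ∑ a, r a * M (Fin.castSucc a) w' := by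
      intro w'; simp [hV, hTdef, Finset.sum_apply, smul_eq_mul]
    have hVne : V ≠ 0 := by
      intro h0
      apply hr
      funext a
      exact Fintype.linearIndependent_iff.mp hT r (by rw [← hV]; exact h0) a
    have hVw : V w ≠ 0 := by
      intro h0
      apply hVne
      funext w'
      by_cases hw : w' = w
      · rw [hw, h0]; rfl
      · rw [hVapp, hzero w' hw]; rfl
    set c : k := V w with hc
    have hVeq : V = c • (Pi.single w (1 : k) : Fin (n + 1) → k) := by
      funext w'
      by_cases hw : w' = w
      · subst hw; simp [hc]
      · rw [Pi.smul_apply, Pi.single_apply, if_neg hw, smul_zero, hVapp, hzero w' hw]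
    have : (Pi.single w (1 : k) : Fin (n + 1) → k) = c⁻¹ • V := by
      rw [hVeq, smul_smul, inv_mul_cancel₀ hVw, one_smul]
    rw [this]
    exact Submodule.smul_mem _ _ hVmem
  have key : ∀ w : Fin (n + 1), (Pi.single w (1 : k) : Fin (n + 1) → k) ∈ Submodule.span k (Set.range T) := by
    intro w
    refine Fin.lastCases ?_ (fun m => ?_) w
    · obtain ⟨r, hr, hrA⟩ := Matrix.exists_vecMul_eq_zero_iff.mpr hA
      refine hcomb r (Fin.last n) hr fun w' hw' => ?_
      obtain ⟨b', rfl⟩ : ∃ b' : Fin n, Fin.castSucc b' = w' := by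
        rcases Fin.eq_castSucc_or_eq_last w' with ⟨b', hb'⟩ | h
        · exact ⟨b', hb'.symm⟩
        · exact absurd h hw'
      have := congrFun hrA b'
      simpa [Matrix.vecMul, dotProduct, hAdef] using this
    · obtain ⟨r, hr, hrB⟩ := Matrix.exists_vecMul_eq_zero_iff.mpr (hB m)
      refine hcomb r (Fin.castSucc m) hr fun w' hw' => ?_
      rcases Fin.eq_castSucc_or_eq_last w' with ⟨b', rfl⟩ | rfl
      · have hbm : b' ≠ m := fun h => hw' (by rw [h])
        have := congrFun hrB b'
        simpa [Matrix.vecMul, dotProduct, Matrix.updateCol_apply, hbm, hAdef] using this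
      · have := congrFun hrB m
        simpa [Matrix.vecMul, dotProduct, Matrix.updateCol_apply] using this
  -- so the span of the `n` vectors `T a` is everything: dimension contradiction
  have htop : Submodule.span k (Set.range T) = ⊤ := by
    apply top_le_iff.mp
    rw [← (Pi.basisFun k (Fin (n + 1))).span_eq, Submodule.span_le]
    rintro _ ⟨w, rfl⟩
    simpa [Pi.basisFun_apply] using key w
  have h1 : (Set.range T).finrank k ≤ n := by simpa using finrank_range_le_card (R := k) T
  have h2 : (Set.range T).finrank k = n + 1 := by
    rw [Set.finrank, htop, finrank_top, Module.finrank_fintype_fun_eq_card, Fintype.card_fin]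
  omega

/-! ## Specialising the idle variable -/

section Specialise

variable {n : ℕ}

/-- The specialisation family `v ↦ s`, `x_w ↦ x_w` (`k⟦x₀..xₙ, v⟧ → k⟦x₀..xₙ⟧`). [OURS · L1 W4.3] -/
noncomputable def specFam (s : MvPowerSeries (Fin (n + 1)) k) : Fin (n + 2) → MvPowerSeries (Fin (n + 1)) k :=
  Fin.snoc (fun w => X w) s

/-- `specFam s` is the identity on the old variables. [OURS · L1 W4.3] -/
theorem specFam_castSucc (s : MvPowerSeries (Fin (n + 1)) k) (w : Fin (n + 1)) : specFam s (Fin.castSucc w) = X w := by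
  simp [specFam]

/-- `specFam s` sends the idle variable to `s`. [OURS · L1 W4.3] -/
theorem specFam_last (s : MvPowerSeries (Fin (n + 1)) k) : specFam s (Fin.last (n + 1)) = s := by
  simp [specFam]

/-- `specFam s` is substitutable when `s(0) = 0`. [OURS · L1 W4.3] -/
theorem hasSubst_specFam {s : MvPowerSeries (Fin (n + 1)) k} (hs : constantCoeff s = 0) : HasSubst (specFam s) :=
  hasSubst_of_constantCoeff_zero fun w => by
    refine Fin.lastCases ?_ (fun w' => ?_) w
    · rw [specFam_last]; exact hs
    · rw [specFam_castSucc]; exact constantCoeff_X _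

/-- Specialising the idle variable undoes the cylinder. [OURS · L1 W4.3] -/
theorem subst_specFam_cylinder {s : MvPowerSeries (Fin (n + 1)) k} (hs : constantCoeff s = 0) (G : MvPowerSeries (Fin (n + 1)) k) :
    subst (specFam s) (cylinder G) = G := by
  rw [subst_cylinder (hasSubst_specFam hs)]
  simp only [specFam_castSucc]
  exact congrFun subst_self G

/-- An exponent of degree `< 2` is `0` or a `single w 1`. [OURS · L1 W4.3] -/
theorem eq_zero_or_single_of_degree_lt_two {N : ℕ} (d : Fin N →₀ ℕ) (hd : d.degree < 2) :
    d = 0 ∨ ∃ w, d = Finsupp.single w 1 := by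
  classical
  by_cases h0 : d = 0
  · exact Or.inl h0
  right
  obtain ⟨j, hj⟩ : ∃ j, d j ≠ 0 := by
    by_contra! hc
    exact h0 (Finsupp.ext hc)
  have hle : d j ≤ d.degree := Finsupp.le_degree j d
  have hdj : d j = 1 := by omega
  refine ⟨j, ?_⟩
  ext l
  by_cases hl : l = j
  · subst hl; simp [hdj]
  · rw [Finsupp.single_apply, if_neg (Ne.symm hl)]
    have hsum : d.degree = d j + (d - Finsupp.single j (d j)).degree := by
      conv_lhs => rw [← add_tsub_cancel_of_le (Finsupp.single_le_iff.mpr (le_refl (d j)) : Finsupp.single j (d j) ≤ d)]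
      rw [map_add, Finsupp.degree_single]
    have h0' : (d - Finsupp.single j (d j)).degree = 0 := by omega
    rw [Finsupp.degree_eq_zero_iff] at h0'
    have := DFunLike.congr_fun h0' l
    simp [Ne.symm hl] at this
    exact this

/-- LINEAR COEFFICIENTS UNDER A SUBSTITUTION WITHOUT CONSTANT TERMS: only the linear part of `φ` contributes,
`[x_j] φ(a) = ∑_w [x_w]φ · [x_j] a_w` (for `φ(0) = 0`). [OURS · L1 W4.3] -/
theorem coeff_single_one_subst {N M : ℕ} {a : Fin N → MvPowerSeries (Fin M) k} (ha : ∀ w, constantCoeff (a w) = 0)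
    (φ : MvPowerSeries (Fin N) k) (hφ : constantCoeff φ = 0) (j : Fin M) :
    coeff (Finsupp.single j 1) (subst a φ) =
      ∑ w, coeff (Finsupp.single w 1) φ * coeff (Finsupp.single j 1) (a w) := by
  classical
  have has : HasSubst a := hasSubst_of_constantCoeff_zero ha
  -- split off the linear part
  set L : MvPowerSeries (Fin N) k := ∑ w, coeff (Finsupp.single w 1) φ • X w with hL
  set φ₂ := φ - L with hφ₂
  have hφ₂ord : (2 : ℕ∞) ≤ φ₂.order := by
    apply le_order
    intro d hd
    have hd' : d.degree < 2 := by exact_mod_cast hd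
    rcases eq_zero_or_single_of_degree_lt_two d hd' with rfl | ⟨w, rfl⟩
    · rw [hφ₂, map_sub, coeff_zero_eq_constantCoeff_apply, hφ, hL, map_sum]
      simp [coeff_zero_eq_constantCoeff_apply, constantCoeff_X]
    · rw [hφ₂, map_sub, hL, map_sum]
      simp only [coeff_smul, coeff_X]
      rw [Finset.sum_eq_single w]
      · simp
      · intro w' _ hw'
        rw [if_neg (fun h => hw' ((Finsupp.single_left_inj one_ne_zero).mp h).symm), mul_zero]
      · intro h; exact absurd (Finset.mem_univ w) h
  have hsub2 : coeff (Finsupp.single j 1) (subst a φ₂) = 0 := by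
    apply coeff_of_lt_order
    have h1 : (1 : ℕ∞) ≤ ⨅ w, (a w).order := le_iInf fun w => one_le_order_iff_constCoeff_eq_zero.mpr (ha w)
    calc ((Finsupp.degree (Finsupp.single j 1) : ℕ) : ℕ∞) = 1 * 1 := by simp
      _ < 1 * 2 := by decide
      _ ≤ (⨅ w, (a w).order) * φ₂.order := mul_le_mul' h1 hφ₂ord
      _ ≤ (subst a φ₂).order := le_order_subst has φ₂
  have hsplit : subst a φ = subst a L + subst a φ₂ := by rw [← subst_add has, hφ₂, add_sub_cancel]
  rw [hsplit, map_add, hsub2, add_zero, hL, ← coe_substAlgHom has, map_sum, map_sum]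
  refine Finset.sum_congr rfl fun w _ => ?_
  simp only [map_smul, substAlgHom_X, smul_eq_mul]

end Specialise

/-- R4-6b-ii (rule-free) — DESCENT OF TWISTED TRIVIALITY FROM THE CYLINDER: if `F ⊗ 1` is twisted-trivial along the lifted axis
`castSucc i` in the origin-fixing sense, then `F` is twisted-trivial along `xᵢ` (`p ≠ 0`).  Together with
`twistedTrivialAlongFix_cylinder_castSucc` and `twistedTrivialAlongFix_cylinder_last`: the saturated axis directions of `F ⊗ 1`
are EXACTLY the lifts of those of `F` plus the idle direction. [OURS · L1 W4.3, Sketch-L1-idea-1 v4 §9 R4-6b-ii] -/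
theorem twistedTrivialAlongFix_of_cylinder (p : ℕ) (hp : p ≠ 0) {n : ℕ} (F : MvPowerSeries (Fin n) k) (i : Fin n)
    (h : TwistedTrivialAlongFix p (cylinder F) (axisCurve (Fin.castSucc i))) :
    TwistedTrivialAlongFix p F (axisCurve i) := by
  classical
  obtain ⟨-, e, Φ', u', hu', hΦ'0, hfix', hdet', heq'⟩ := h
  have hpe : p ^ e ≠ 0 := pow_ne_zero e hp
  have hΦ's : HasSubst Φ' := hasSubst_of_constantCoeff_zero hΦ'0
  -- the linear part of `Φ'` and its blocks
  set M' : Matrix (Fin (n + 1)) (Fin (n + 1)) k := Matrix.of fun w w' => coeff (Finsupp.single w'.succ 1) (Φ' w) with hM'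
  have hM'det : M'.det ≠ 0 := hdet'.ne_zero
  set A : Matrix (Fin n) (Fin n) k := M'.submatrix Fin.castSucc Fin.castSucc with hA
  set bvec : Fin n → k := fun a => M' (Fin.castSucc a) (Fin.last n) with hbvec
  -- the common construction for a specialisation `v := s`
  have build : ∀ (s : MvPowerSeries (Fin (n + 1)) k) (hs : constantCoeff s = 0)
      (hsK : subst (fun v : Fin (n + 1) => if v = 0 then (X (0 : Fin (n + 1)) : MvPowerSeries (Fin (n + 1)) k) else 0) s = 0)
      (hsdet : IsUnit (Matrix.det (Matrix.of fun a b : Fin n =>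
        coeff (Finsupp.single b.succ 1) (subst (specFam s) (Φ' (Fin.castSucc a)))))),
      TwistedTrivialAlongFix p F (axisCurve i) := by
    intro s hs hsK hsdet
    have hS := hasSubst_specFam (n := n) hs
    refine ⟨fun j => ?_, e, fun a => subst (specFam s) (Φ' (Fin.castSucc a)), subst (specFam s) u', isUnit_subst hS hu',
      fun a => constantCoeff_subst_eq_zero hS (fun w => ?_) (hΦ'0 _), fun a => ?_, hsdet, ?_⟩
    · unfold axisCurve; split_ifs <;> simp [constantCoeff_X]
    · refine Fin.lastCases ?_ (fun w' => ?_) w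
      · rw [specFam_last]; exact hs
      · rw [specFam_castSucc]; exact constantCoeff_X _
    · -- origin-fixing: kill-`x` after specialising = specialising (with `s ↦ 0`) after kill-`x`
      have hK := hasSubst_keep (k := k) (fun v : Fin (n + 1) => v = 0)
      have hKeq : (fun v : Fin (n + 1) => if v = 0 then (X (0 : Fin (n + 1)) : MvPowerSeries (Fin (n + 1)) k) else 0) =
          fun v : Fin (n + 1) => if v = 0 then (X v : MvPowerSeries (Fin (n + 1)) k) else 0 := by
        funext v; by_cases hv : v = 0 <;> simp [hv]
      have hK' := hasSubst_keep (k := k) (fun v : Fin (n + 1 + 1) => v = 0)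
      have hK'eq : (fun v : Fin (n + 1 + 1) => if v = 0 then (X (0 : Fin (n + 1 + 1)) : MvPowerSeries (Fin (n + 1 + 1)) k) else 0) =
          fun v : Fin (n + 1 + 1) => if v = 0 then (X v : MvPowerSeries (Fin (n + 1 + 1)) k) else 0 := by
        funext v; by_cases hv : v = 0 <;> simp [hv]
      have hS0 := hasSubst_specFam (n := n) (s := (0 : MvPowerSeries (Fin (n + 1)) k)) (map_zero _)
      have hsK' := hsK
      rw [hKeq] at hsK'
      rw [hKeq, subst_comp_subst_apply hS hK]
      -- the composite family is `specFam 0 ∘ K'`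
      have hfam : (fun w : Fin (n + 1 + 1) => subst (fun v : Fin (n + 1) => if v = 0 then (X v : MvPowerSeries (Fin (n + 1)) k) else 0)
          (specFam s w)) = fun w => subst (specFam 0)
            ((fun v : Fin (n + 1 + 1) => if v = 0 then (X v : MvPowerSeries (Fin (n + 1 + 1)) k) else 0) w) := by
        funext w
        refine Fin.lastCases ?_ (fun w' => ?_) w
        · beta_reduce
          rw [specFam_last, if_neg (ne_of_gt Fin.last_pos), ← coe_substAlgHom hS0, map_zero]
          exact hsK'
        · beta_reduce
          rw [specFam_castSucc, subst_X hK]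
          by_cases hw : w' = 0
          · subst hw
            simp only [Fin.castSucc_zero, if_true]
            rw [subst_X hS0]
            exact (specFam_castSucc 0 0).symm
          · rw [if_neg hw, if_neg (fun h => hw (Fin.castSucc_eq_zero_iff.mp h)), ← coe_substAlgHom hS0, map_zero]
      rw [hfam, ← subst_comp_subst_apply hK' hS0, ← hK'eq, hfix', ← coe_substAlgHom hS0, map_zero]
    · -- the identity: specialise `heq'`
      have hT' := hasSubst_translateFamilyPowC (p ^ e) hpe (axisCurve (k := k) (Fin.castSucc i))
        (fun j => by unfold axisCurve; split_ifs <;> simp [constantCoeff_X])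
      have hT := hasSubst_translateFamilyPowC (p ^ e) hpe (axisCurve (k := k) i)
        (fun j => by unfold axisCurve; split_ifs <;> simp [constantCoeff_X])
      have ha' : HasSubst (fun _ : Fin 1 => (X (0 : Fin (n + 1 + 1)) : MvPowerSeries (Fin (n + 1 + 1)) k) ^ (p ^ e)) :=
        hasSubst_of_constantCoeff_zero fun _ => by simp [constantCoeff_X, zero_pow hpe]
      have ha : HasSubst (fun _ : Fin 1 => (X (0 : Fin (n + 1)) : MvPowerSeries (Fin (n + 1)) k) ^ (p ^ e)) :=
        hasSubst_of_constantCoeff_zero fun _ => by simp [constantCoeff_X, zero_pow hpe]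
      -- the restricted families
      have hT'c : HasSubst (fun a : Fin n => X (Fin.castSucc a).succ +
          subst (fun _ : Fin 1 => (X (0 : Fin (n + 1 + 1)) : MvPowerSeries (Fin (n + 1 + 1)) k) ^ (p ^ e))
            (axisCurve (k := k) (Fin.castSucc i) (Fin.castSucc a))) :=
        hasSubst_of_constantCoeff_zero fun a => by
          rw [map_add, constantCoeff_X, zero_add]
          exact constantCoeff_subst_eq_zero ha' (fun _ => by simp [constantCoeff_X, zero_pow hpe])
            (by unfold axisCurve; split_ifs <;> simp [constantCoeff_X])
      have hΦ'c : HasSubst (fun a : Fin n => Φ' (Fin.castSucc a)) := hasSubst_of_constantCoeff_zero fun a => hΦ'0 _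
      -- `specFam s` maps the lifted translation family to the translation family of `F`
      have hTT : (fun a : Fin n => subst (specFam s) (X (Fin.castSucc a).succ +
          subst (fun _ : Fin 1 => (X (0 : Fin (n + 1 + 1)) : MvPowerSeries (Fin (n + 1 + 1)) k) ^ (p ^ e))
            (axisCurve (k := k) (Fin.castSucc i) (Fin.castSucc a)))) =
          fun a : Fin n => X a.succ +
            subst (fun _ : Fin 1 => (X (0 : Fin (n + 1)) : MvPowerSeries (Fin (n + 1)) k) ^ (p ^ e)) (axisCurve (k := k) i a) := by
        funext a
        rw [subst_add hS, subst_X hS, Fin.succ_castSucc, specFam_castSucc]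
        congr 1
        unfold axisCurve
        by_cases hj : a = i
        · subst hj
          rw [if_pos rfl, if_pos rfl, subst_X ha', subst_X ha, subst_pow hS, subst_X hS]
          exact congrArg (· ^ (p ^ e)) (specFam_castSucc s 0)
        · rw [if_neg (fun h' => hj (Fin.castSucc_injective _ h')), if_neg hj, ← coe_substAlgHom ha', map_zero,
            ← coe_substAlgHom ha, map_zero, ← coe_substAlgHom hS, map_zero]
      have hE := congrArg (subst (specFam s)) heq'
      rw [subst_mul hS, subst_cylinder hT', subst_cylinder hΦ's, subst_comp_subst_apply hT'c hS,
        subst_comp_subst_apply hΦ'c hS, hTT] at hE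
      exact hE
  -- linear part of the specialised witness: `A`, resp. `A` with column `m` shifted by `b`
  have hcoeffX : ∀ j w' : Fin (n + 1), coeff (Finsupp.single j 1) (X w' : MvPowerSeries (Fin (n + 1)) k) =
      if j = w' then 1 else 0 := fun j w' => by
    rw [coeff_X]
    by_cases h : j = w'
    · subst h; simp
    · rw [if_neg, if_neg h]
      exact fun h' => h ((Finsupp.single_left_inj one_ne_zero).mp h')
  have hlin : ∀ (s : MvPowerSeries (Fin (n + 1)) k) (hs : constantCoeff s = 0) (a b : Fin n),
      coeff (Finsupp.single b.succ 1) (subst (specFam s) (Φ' (Fin.castSucc a))) =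
        A a b + bvec a * coeff (Finsupp.single b.succ 1) s := by
    intro s hs a b
    have hsw : ∀ w, constantCoeff (specFam s w) = 0 := fun w => by
      refine Fin.lastCases ?_ (fun w' => ?_) w
      · rw [specFam_last]; exact hs
      · rw [specFam_castSucc]; exact constantCoeff_X _
    rw [coeff_single_one_subst hsw _ (hΦ'0 _), Fin.sum_univ_castSucc, specFam_last]
    congr 1
    simp only [specFam_castSucc, hcoeffX]
    rw [Finset.sum_eq_single b.succ]
    · rw [if_pos rfl, mul_one, hA, Matrix.submatrix_apply, hM', Matrix.of_apply, Fin.succ_castSucc]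
    · intro w' _ hw'
      rw [if_neg (Ne.symm hw'), mul_zero]
    · intro h; exact absurd (Finset.mem_univ _) h
  by_cases hAdet : A.det = 0
  · -- a column of `A` must be shifted: specialise `v := x_m`
    obtain ⟨m, hm⟩ := (exists_det_ne_zero_principal_or_updateCol M' hM'det).resolve_left (by rw [← hA]; exact not_not.mpr hAdet)
    refine build (X m.succ) (constantCoeff_X _) ?_ ?_
    · have hK := hasSubst_keep (k := k) (fun v : Fin (n + 1) => v = 0)
      have hKeq : (fun v : Fin (n + 1) => if v = 0 then (X (0 : Fin (n + 1)) : MvPowerSeries (Fin (n + 1)) k) else 0) =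
          fun v : Fin (n + 1) => if v = 0 then (X v : MvPowerSeries (Fin (n + 1)) k) else 0 := by
        funext v; by_cases hv : v = 0 <;> simp [hv]
      rw [hKeq, subst_X hK]
      simp [Fin.succ_ne_zero]
    · have hMeq : (Matrix.of fun a b : Fin n => coeff (Finsupp.single b.succ 1) (subst (specFam (X m.succ)) (Φ' (Fin.castSucc a)))) =
          A.updateCol m (fun a => A a m + bvec a) := by
        ext a b
        rw [Matrix.of_apply, hlin _ (constantCoeff_X _), Matrix.updateCol_apply, coeff_X]
        by_cases hb : b = m
        · subst hb; simp
        · rw [if_neg (fun h => hb (Fin.succ_injective _ ((Finsupp.single_left_inj one_ne_zero).mp h))), if_neg hb, mul_zero,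
            add_zero]
      have hsum : (fun a => A a m + bvec a) = (fun a => A a m) + bvec := rfl
      rw [hMeq, hsum, Matrix.det_updateCol_add, isUnit_iff_ne_zero]
      have : A.updateCol m (fun a => A a m) = A := by
        ext a b; rw [Matrix.updateCol_apply]; split_ifs with h <;> simp [h]
      rw [this, hAdet, zero_add]
      exact hm
  · -- the principal block is invertible: specialise `v := 0`
    refine build 0 (map_zero _) ?_ ?_
    · have hK := hasSubst_keep (k := k) (fun v : Fin (n + 1) => v = 0)
      have hKeq : (fun v : Fin (n + 1) => if v = 0 then (X (0 : Fin (n + 1)) : MvPowerSeries (Fin (n + 1)) k) else 0) =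
          fun v : Fin (n + 1) => if v = 0 then (X v : MvPowerSeries (Fin (n + 1)) k) else 0 := by
        funext v; by_cases hv : v = 0 <;> simp [hv]
      rw [hKeq, ← coe_substAlgHom hK, map_zero]
    · have hMeq : (Matrix.of fun a b : Fin n => coeff (Finsupp.single b.succ 1) (subst (specFam 0) (Φ' (Fin.castSucc a)))) = A := by
        ext a b
        rw [Matrix.of_apply, hlin _ (map_zero _), map_zero, mul_zero, add_zero]
      rw [hMeq, isUnit_iff_ne_zero]
      exact hAdet
where
  /-- The translation family along `γ` with parameter `σ^q` is substitutable (`q ≠ 0`, `γ(0) = 0`). -/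
  hasSubst_translateFamilyPowC {N : ℕ} (q : ℕ) (hq : q ≠ 0) (γ : Fin N → MvPowerSeries (Fin 1) k)
      (hγ : ∀ j, constantCoeff (γ j) = 0) :
      HasSubst (fun j : Fin N => X j.succ +
        subst (fun _ : Fin 1 => (X (0 : Fin (N + 1)) : MvPowerSeries (Fin (N + 1)) k) ^ q) (γ j)) := by
    have ha : HasSubst (fun _ : Fin 1 => (X (0 : Fin (N + 1)) : MvPowerSeries (Fin (N + 1)) k) ^ q) :=
      hasSubst_of_constantCoeff_zero fun _ => by simp [constantCoeff_X, zero_pow hq]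
    exact hasSubst_of_constantCoeff_zero fun j => by
      rw [map_add, constantCoeff_X, zero_add]
      exact constantCoeff_subst_eq_zero ha (fun _ => by simp [constantCoeff_X, zero_pow hq]) (hγ j)

/-- R4-6b at the predicate level, EXACT FORM: the Fix-saturated axis directions of the cylinder `F ⊗ 1` are precisely the idle
direction and the lifts of the Fix-saturated axis directions of `F` (`p ≠ 0`). [OURS · L1 W4.3] -/
theorem twistedTrivialAlongFix_cylinder_iff (p : ℕ) (hp : p ≠ 0) {n : ℕ} (F : MvPowerSeries (Fin n) k) (w : Fin (n + 1)) :
    TwistedTrivialAlongFix p (cylinder F) (axisCurve w) ↔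
      w = Fin.last n ∨ ∃ i : Fin n, w = Fin.castSucc i ∧ TwistedTrivialAlongFix p F (axisCurve i) := by
  refine Fin.lastCases ?_ (fun i => ?_) w
  · exact ⟨fun _ => Or.inl rfl, fun _ => twistedTrivialAlongFix_cylinder_last p F⟩
  · constructor
    · intro h
      exact Or.inr ⟨i, rfl, twistedTrivialAlongFix_of_cylinder p hp F i h⟩
    · rintro (h | ⟨i', hi', h⟩)
      · exact absurd h (ne_of_lt (Fin.castSucc_lt_last i))
      · rw [Fin.castSucc_injective _ hi']
        exact twistedTrivialAlongFix_cylinder_castSucc p hp F i' h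

end GradedGame

end Summit.ResolutionOfSingularities.ResolutionOfSingularities.Theorems
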